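import Summits.Parity.GeneralizedHardyLittlewood.Theorems.LeeYangFibresFibrationLemmaAsymptotics
import Summits.Parity.GeneralizedHardyLittlewood.Theorems.LeeYangFibresFibrationLemmaAveraging
import HarnessLib

/-!
# Fibration lemma (`DimOne → GeneralizedHardyLittlewood`), part 10b: the averaging error at `z = z(N)`

Support file for the statement item `FibrationLemma : DimOne → GeneralizedHardyLittlewood`
(Green–Tao 2010, §1, remark after Conj. 1.2). With the bounds of part 10a, the three terms of
`avgError` (part 9a) at the truncation `z = z(N)` are each `≪ u^{t+1} N^{d+1} (1/log N + 1/√N)`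
with `u = 1 + log log N` (`term1_le`, `term2_le`, `term3_le`), whence

  `avgError(N, z(N)) ≤ K · (1 + log log N)^{2t} · N^{d+1} · (1/log N + 1/√N)`   (`avgError_le_of_large`)

for an explicit constant `K = avgConst d t L`.
-/

noncomputable section

open Finset Filter Real
open scoped Topology

namespace Summit.Parity.GeneralizedHardyLittlewood.Theorems

open Literature.NumberTheory.Sieve

variable {d t : ℕ}

/-! ### The three terms of the averaging error -/

section Terms

variable {n y u : ℝ} {z D : ℕ}

/-- Term 1 of `avgError`. [folklore] -/
theorem term1_le (hd : 1 ≤ d) (hn0 : 0 < n) (hn1 : 1 ≤ n) (hy0 : 0 < y) (hu1 : 1 ≤ u)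
    (hH0 : 0 ≤ headMax t z) (hH : headMax t z ≤ Real.exp (5 * t) * u ^ t)
    (hX : Real.exp (tailXmax t D z) ≤ Real.exp (32 * (t : ℝ) ^ 3 * d))
    {a : ℝ} (ha0 : 0 ≤ a) (hDz : 2 * (D : ℝ) / z ≤ a * n / y) (hll : Real.log (Real.log D) ≤ u)
    (hsq : Real.sqrt n ≤ n) (hsq0 : 0 < Real.sqrt n) :
    2 * n * headMax t z * Real.exp (tailXmax t D z) *
        (2 * (t : ℝ) ^ 3 * (2 * n + 1) ^ (d - 1) * (2 * (D : ℝ) / z + Real.log (Real.log D) + 4)) ≤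
      (4 * (t : ℝ) ^ 3 * 3 ^ (d - 1) * Real.exp (5 * t) * Real.exp (32 * (t : ℝ) ^ 3 * d)) * a *
          (u ^ (t + 1) * (n ^ (d + 1) / y)) +
        (4 * (t : ℝ) ^ 3 * 3 ^ (d - 1) * Real.exp (5 * t) * Real.exp (32 * (t : ℝ) ^ 3 * d)) * 5 *
          (u ^ (t + 1) * (n ^ (d + 1) / Real.sqrt n)) := by
  set α₁ : ℝ := 4 * (t : ℝ) ^ 3 * 3 ^ (d - 1) * Real.exp (5 * t) * Real.exp (32 * (t : ℝ) ^ 3 * d) with hα₁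
  have hu0 : 0 < u := by linarith
  have hn1' : 0 ≤ 2 * n + 1 := by linarith
  have h2N1 : (2 * n + 1) ^ (d - 1) ≤ 3 ^ (d - 1) * n ^ (d - 1) := by
    rw [← mul_pow]; exact pow_le_pow_left₀ hn1' (by linarith) _
  have hnd : n ^ (d - 1) * n = n ^ d := by rw [← pow_succ, Nat.sub_add_cancel hd]
  have hnd1 : n ^ d * n = n ^ (d + 1) := by rw [← pow_succ]
  have hbr : 2 * (D : ℝ) / z + Real.log (Real.log D) + 4 ≤ a * n / y + 5 * u := by linarith
  set P := 2 * n * headMax t z * Real.exp (tailXmax t D z) * (2 * (t : ℝ) ^ 3 * (2 * n + 1) ^ (d - 1)) with hP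
  have hP0 : 0 ≤ P := by positivity
  have hPle : P ≤ α₁ * u ^ t * n ^ d := by
    calc P ≤ 2 * n * (Real.exp (5 * t) * u ^ t) * Real.exp (32 * (t : ℝ) ^ 3 * d) *
          (2 * (t : ℝ) ^ 3 * (3 ^ (d - 1) * n ^ (d - 1))) := by rw [hP]; gcongr
      _ = α₁ * u ^ t * (n ^ (d - 1) * n) := by rw [hα₁]; ring
      _ = α₁ * u ^ t * n ^ d := by rw [hnd]
  have hbound0 : 0 ≤ a * n / y + 5 * u := by positivity
  have hut : u ^ t ≤ u ^ (t + 1) := pow_le_pow_right₀ hu1 (by omega)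
  have hndsq : n ^ d ≤ n ^ (d + 1) / Real.sqrt n := by
    rw [le_div_iff₀ hsq0, ← hnd1]; exact mul_le_mul_of_nonneg_left hsq (by positivity)
  calc _ = P * (2 * (D : ℝ) / z + Real.log (Real.log D) + 4) := by rw [hP]; ring
    _ ≤ P * (a * n / y + 5 * u) := mul_le_mul_of_nonneg_left hbr hP0
    _ ≤ (α₁ * u ^ t * n ^ d) * (a * n / y + 5 * u) := mul_le_mul_of_nonneg_right hPle hbound0
    _ = α₁ * a * (u ^ t * ((n ^ d * n) / y)) + α₁ * 5 * ((u ^ t * u) * n ^ d) := by ring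
    _ = α₁ * a * (u ^ t * (n ^ (d + 1) / y)) + α₁ * 5 * (u ^ (t + 1) * n ^ d) := by rw [hnd1, ← pow_succ]
    _ ≤ α₁ * a * (u ^ (t + 1) * (n ^ (d + 1) / y)) + α₁ * 5 * (u ^ (t + 1) * (n ^ (d + 1) / Real.sqrt n)) := by
        gcongr

/-- Term 2 of `avgError`. [folklore] -/
theorem term2_le {N : ℕ} (hd : 1 ≤ d) (hn : n = (N : ℝ)) (hn0 : 0 < n) (hu1 : 1 ≤ u)
    (hH : headMax t z ≤ Real.exp (5 * t) * u ^ t) {Q : ℕ}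
    (hQ : (Q : ℝ) ^ d ≤ Real.sqrt n) (hsq1 : 1 ≤ Real.sqrt n) (hsq0 : 0 < Real.sqrt n)
    (hsqn : Real.sqrt n * Real.sqrt n = n) :
    headMax t z * (((t * t * (2 * N + 1) ^ (d - 1) : ℕ) : ℝ) * (2 * n) + (((2 * N + 1) ^ d : ℕ) : ℝ) +
        (Q : ℝ) ^ d * (((d : ℝ) + 1) * 4 ^ d * (((2 * N : ℕ) : ℝ)) ^ d)) ≤
      (Real.exp (5 * t) * (2 * (t : ℝ) ^ 2 * 3 ^ (d - 1) + 3 ^ d + (d + 1) * 8 ^ d)) *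
        (u ^ (t + 1) * (n ^ (d + 1) / Real.sqrt n)) := by
  have hu0 : 0 < u := by linarith
  have hn1 : 0 ≤ 2 * n + 1 := by linarith
  have h3 : 2 * n + 1 ≤ 3 * n := by
    have : (1 : ℝ) ≤ n := by nlinarith
    linarith
  have h2N1 : (2 * n + 1) ^ (d - 1) ≤ 3 ^ (d - 1) * n ^ (d - 1) := by
    rw [← mul_pow]; exact pow_le_pow_left₀ hn1 h3 _
  have h2N1d : (((2 * N + 1) ^ d : ℕ) : ℝ) ≤ 3 ^ d * n ^ d := by
    push_cast; rw [← hn, ← mul_pow]; exact pow_le_pow_left₀ hn1 h3 _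
  have hbadc : ((t * t * (2 * N + 1) ^ (d - 1) : ℕ) : ℝ) ≤ (t : ℝ) ^ 2 * (3 ^ (d - 1) * n ^ (d - 1)) := by
    push_cast; rw [← hn, sq]; exact mul_le_mul_of_nonneg_left h2N1 (by positivity)
  have h2Nd : (((2 * N : ℕ) : ℝ)) ^ d = 2 ^ d * n ^ d := by push_cast; rw [← hn, mul_pow]
  have hnd : n ^ (d - 1) * n = n ^ d := by rw [← pow_succ, Nat.sub_add_cancel hd]
  have hnd1 : n ^ d * n = n ^ (d + 1) := by rw [← pow_succ]
  have hndsq' : n ^ d * Real.sqrt n = n ^ (d + 1) / Real.sqrt n := by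
    rw [eq_div_iff hsq0.ne', mul_assoc, hsqn, hnd1]
  have hin : ((t * t * (2 * N + 1) ^ (d - 1) : ℕ) : ℝ) * (2 * n) + (((2 * N + 1) ^ d : ℕ) : ℝ) +
      (Q : ℝ) ^ d * (((d : ℝ) + 1) * 4 ^ d * (((2 * N : ℕ) : ℝ)) ^ d) ≤
      (2 * (t : ℝ) ^ 2 * 3 ^ (d - 1) + 3 ^ d + (d + 1) * 8 ^ d) * (n ^ d * Real.sqrt n) := by
    rw [h2Nd]
    have e1 : ((t * t * (2 * N + 1) ^ (d - 1) : ℕ) : ℝ) * (2 * n) ≤ 2 * (t : ℝ) ^ 2 * 3 ^ (d - 1) * (n ^ d * Real.sqrt n) := by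
      calc _ ≤ (t : ℝ) ^ 2 * (3 ^ (d - 1) * n ^ (d - 1)) * (2 * n) := mul_le_mul_of_nonneg_right hbadc (by positivity)
        _ = 2 * (t : ℝ) ^ 2 * 3 ^ (d - 1) * (n ^ (d - 1) * n) * 1 := by ring
        _ ≤ 2 * (t : ℝ) ^ 2 * 3 ^ (d - 1) * (n ^ (d - 1) * n) * Real.sqrt n := by gcongr
        _ = _ := by rw [hnd]; ring
    have e2 : (((2 * N + 1) ^ d : ℕ) : ℝ) ≤ 3 ^ d * (n ^ d * Real.sqrt n) := by
      calc _ ≤ 3 ^ d * n ^ d * 1 := by rw [mul_one]; exact h2N1d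
        _ ≤ 3 ^ d * n ^ d * Real.sqrt n := by gcongr
        _ = _ := by ring
    have e3 : (Q : ℝ) ^ d * (((d : ℝ) + 1) * 4 ^ d * (2 ^ d * n ^ d)) ≤ ((d : ℝ) + 1) * 8 ^ d * (n ^ d * Real.sqrt n) := by
      calc _ ≤ Real.sqrt n * (((d : ℝ) + 1) * 4 ^ d * (2 ^ d * n ^ d)) := mul_le_mul_of_nonneg_right hQ (by positivity)
        _ = ((d : ℝ) + 1) * (4 ^ d * 2 ^ d) * (n ^ d * Real.sqrt n) := by ring
        _ = _ := by rw [← mul_pow]; norm_num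
    calc _ ≤ 2 * (t : ℝ) ^ 2 * 3 ^ (d - 1) * (n ^ d * Real.sqrt n) + 3 ^ d * (n ^ d * Real.sqrt n) +
          ((d : ℝ) + 1) * 8 ^ d * (n ^ d * Real.sqrt n) := add_le_add (add_le_add e1 e2) e3
      _ = _ := by ring
  have hut : u ^ t ≤ u ^ (t + 1) := pow_le_pow_right₀ hu1 (by omega)
  calc _ ≤ (Real.exp (5 * t) * u ^ t) * ((2 * (t : ℝ) ^ 2 * 3 ^ (d - 1) + 3 ^ d + (d + 1) * 8 ^ d) * (n ^ d * Real.sqrt n)) :=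
        mul_le_mul hH hin (by positivity) (by positivity)
    _ = (Real.exp (5 * t) * (2 * (t : ℝ) ^ 2 * 3 ^ (d - 1) + 3 ^ d + (d + 1) * 8 ^ d)) * (u ^ t * (n ^ (d + 1) / Real.sqrt n)) := by
        rw [hndsq']; ring
    _ ≤ _ := by gcongr

/-- Term 3 of `avgError`. [folklore] -/
theorem term3_le {L : ℕ} (hy0 : 0 < y) (hu1 : 1 ≤ u) (hz2 : (2 : ℝ) ≤ z) (hn0 : 0 < n)
    {c₀ : ℝ} (hc₀ : 0 < c₀) (hyz : y ≤ 2 * c₀ * z) {C₃ : ℝ} (hC₃ : 1 ≤ C₃)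
    (hHbar : headBar t L D ≤ 2 ^ (t * (tailThreshold t L + 1)) * Real.exp ((t : ℝ) ^ 2) * (C₃ ^ (t - 1) * u ^ (t - 1))) :
    (2 * n) ^ (d + 1) * headBar t L D * ((2 * (t : ℝ) ^ 3 / z) * Real.exp (2 * (t : ℝ) ^ 3 / z)) ≤
      (2 ^ (d + 1) * 2 ^ (t * (tailThreshold t L + 1)) * Real.exp ((t : ℝ) ^ 2) * C₃ ^ (t - 1) *
          (4 * (t : ℝ) ^ 3 * c₀) * Real.exp ((t : ℝ) ^ 3)) * (u ^ (t + 1) * (n ^ (d + 1) / y)) := by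
  have hu0 : 0 < u := by linarith
  have hz0 : (0 : ℝ) < z := by linarith
  have hsmall : 2 * (t : ℝ) ^ 3 / z ≤ 4 * (t : ℝ) ^ 3 * c₀ / y := by
    rw [div_le_div_iff₀ hz0 hy0]
    calc 2 * (t : ℝ) ^ 3 * y ≤ 2 * (t : ℝ) ^ 3 * (2 * c₀ * z) := mul_le_mul_of_nonneg_left hyz (by positivity)
      _ = _ := by ring
  have hsmall' : 2 * (t : ℝ) ^ 3 / z ≤ (t : ℝ) ^ 3 :=
    calc 2 * (t : ℝ) ^ 3 / z ≤ 2 * (t : ℝ) ^ 3 / 2 := div_le_div_of_nonneg_left (by positivity) (by norm_num) hz2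
      _ = (t : ℝ) ^ 3 := by ring
  have hexp : Real.exp (2 * (t : ℝ) ^ 3 / z) ≤ Real.exp ((t : ℝ) ^ 3) := Real.exp_le_exp.mpr hsmall'
  have hut : u ^ (t - 1) ≤ u ^ (t + 1) := pow_le_pow_right₀ hu1 (by omega)
  calc _ ≤ (2 * n) ^ (d + 1) * (2 ^ (t * (tailThreshold t L + 1)) * Real.exp ((t : ℝ) ^ 2) * (C₃ ^ (t - 1) * u ^ (t - 1))) *
        ((4 * (t : ℝ) ^ 3 * c₀ / y) * Real.exp ((t : ℝ) ^ 3)) :=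
        mul_le_mul (mul_le_mul_of_nonneg_left hHbar (by positivity))
          (mul_le_mul hsmall hexp (by positivity) (by positivity)) (by positivity) (by positivity)
    _ = (2 ^ (d + 1) * 2 ^ (t * (tailThreshold t L + 1)) * Real.exp ((t : ℝ) ^ 2) * C₃ ^ (t - 1) *
          (4 * (t : ℝ) ^ 3 * c₀) * Real.exp ((t : ℝ) ^ 3)) * (u ^ (t - 1) * (n ^ (d + 1) / y)) := by
        rw [mul_pow]; ring
    _ ≤ _ := by gcongr

end Terms

/-! ### The averaging error at `z = z(N)` -/

/-- The constant of the final bound. [folklore] -/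
def avgConst (d t L : ℕ) : ℝ :=
  tailConst t ^ (t - 1) *
    ((4 * (t : ℝ) ^ 3 * 3 ^ (d - 1) * Real.exp (5 * t) * Real.exp (32 * (t : ℝ) ^ 3 * d)) *
        (8 * d * Real.log 16 * L * L * (d + 1)) +
      (4 * (t : ℝ) ^ 3 * 3 ^ (d - 1) * Real.exp (5 * t) * Real.exp (32 * (t : ℝ) ^ 3 * d)) * 5 +
      Real.exp (5 * t) * (2 * (t : ℝ) ^ 2 * 3 ^ (d - 1) + 3 ^ d + (d + 1) * 8 ^ d) +
      2 ^ (d + 1) * 2 ^ (t * (tailThreshold t L + 1)) * Real.exp ((t : ℝ) ^ 2) * tailConst t ^ (t - 1) *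
        (4 * (t : ℝ) ^ 3 * ((d : ℝ) * Real.log 16)) * Real.exp ((t : ℝ) ^ 3))

/-- **The averaging error is small**: for `N` large (`N ≥ 3`, `N ≥ 16^{2d}`, `N ≥ 2L²(d+1)`),
`avgError(N, z(N)) ≤ K · (1 + log log N)^{2t} · N^{d+1} · (1/log N + 1/√N)`.
[cite: GreenTao2010, §1 (remark after Conj. 1.2)] -/
theorem avgError_le_of_large (hd : 1 ≤ d) (ht : 1 ≤ t) {L N : ℕ} (hL : 1 ≤ L) (hN3 : 3 ≤ N)
    (hN16 : (16 ^ d) ^ 2 ≤ N) (hND : 2 * L * L * (d + 1) ≤ N) :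
    avgError d t L N (zOf d N) ≤ avgConst d t L * (1 + Real.log (Real.log N)) ^ (2 * t) *
      ((N : ℝ) ^ (d + 1) / Real.log N + (N : ℝ) ^ (d + 1) / Real.sqrt N) := by
  unfold avgError avgConst
  set n : ℝ := (N : ℝ) with hn
  set y : ℝ := Real.log n with hy
  set u : ℝ := 1 + Real.log y with hu
  set z : ℕ := zOf d N with hzdef
  set D : ℕ := discMax d L N with hDdef
  set C₃ : ℝ := tailConst t with hC₃def
  set c₀ : ℝ := (d : ℝ) * Real.log 16 with hc₀def
  have hN1 : 1 ≤ N := by omega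
  have hn3 : (3 : ℝ) ≤ n := by rw [hn]; exact_mod_cast hN3
  have hn0 : (0 : ℝ) < n := by linarith
  have hy1 : 1 < y := by
    rw [hy, Real.lt_log_iff_exp_lt hn0]
    exact lt_of_lt_of_le Real.exp_one_lt_three hn3
  have hy0 : 0 < y := by linarith
  have hlogy : 0 ≤ Real.log y := Real.log_nonneg hy1.le
  have hu1 : 1 ≤ u := by rw [hu]; linarith
  have hu0 : 0 < u := by linarith
  have hz2 : 2 ≤ z := le_zOf hd hN16
  have hz2r : (2 : ℝ) ≤ z := by exact_mod_cast hz2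
  have hz0 : (0 : ℝ) < z := by linarith
  have hz1 : 1 ≤ z := by omega
  have hc₀ : 1 ≤ c₀ := one_le_d_mul_log hd
  have hc₀0 : 0 < c₀ := by linarith
  have hzy : (z : ℝ) ≤ y := zOf_le_log hd hN1
  have hybig : 2 * c₀ ≤ y := le_trans (by nlinarith) (zOf_mul_le_log (d := d) hN1)
  have hyz : y / (2 * c₀) ≤ z := log_div_le_zOf hd hN1 hybig
  have hyz' : y ≤ 2 * c₀ * z := by rw [div_le_iff₀ (by positivity)] at hyz; linarith
  have hD2 : 2 ≤ D := two_le_discMax hL hN1 d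
  have hD1 : 1 ≤ D := by omega
  have hlogD : Real.log D ≤ 2 * y := log_discMax_le hN1 hND
  have hlogD0 : 0 < Real.log D := Real.log_pos (by exact_mod_cast (by omega : 1 < D))
  have hexp5 : Real.exp 5 ^ t = Real.exp (5 * t) := by rw [← Real.exp_nat_mul]; ring_nf
  have hH : headMax t z ≤ Real.exp (5 * t) * u ^ t := by
    rw [← hexp5, ← mul_pow]; exact headMax_le_pow hz2 hzy
  have hH0 : 0 ≤ headMax t z := headMax_nonneg t hz1
  have hC3 : 1 ≤ C₃ := one_le_tailConst ht
  have hB : tailBound t D ≤ C₃ ^ (t - 1) * u ^ (t - 1) := by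
    rw [← mul_pow]; exact tailBound_le_pow ht hD2 hy1.le hlogD
  have hB0 : 0 ≤ tailBound t D := zero_le_one.trans (one_le_tailBound _ _)
  have hX : Real.exp (tailXmax t D z) ≤ Real.exp (32 * (t : ℝ) ^ 3 * d) :=
    Real.exp_le_exp.mpr (tailXmax_le_const hd hD1 hz2 hy0 hlogD hyz)
  have hHbar : headBar t L D ≤ 2 ^ (t * (tailThreshold t L + 1)) * Real.exp ((t : ℝ) ^ 2) * (C₃ ^ (t - 1) * u ^ (t - 1)) := by
    unfold headBar
    calc (2 : ℝ) ^ (t * (tailThreshold t L + 1)) * tailBound t D * Real.exp ((t : ℝ) ^ 2)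
        = 2 ^ (t * (tailThreshold t L + 1)) * Real.exp ((t : ℝ) ^ 2) * tailBound t D := by ring
      _ ≤ _ := mul_le_mul_of_nonneg_left hB (by positivity)
  have hHbar0 : 0 ≤ headBar t L D := headBar_nonneg _ _ _
  have hQ : ((primorial z : ℕ) : ℝ) ^ d ≤ Real.sqrt n := primorial_zOf_pow_le_sqrt hN1
  have hsq1 : 1 ≤ Real.sqrt n := by rw [Real.le_sqrt zero_le_one hn0.le]; linarith
  have hsqn : Real.sqrt n * Real.sqrt n = n := Real.mul_self_sqrt hn0.le
  have hsq0 : 0 < Real.sqrt n := by linarith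
  have hsq : Real.sqrt n ≤ n := by nlinarith
  have hll : Real.log (Real.log D) ≤ u := by
    have h1 : Real.log (Real.log D) ≤ Real.log (2 * y) := Real.log_le_log hlogD0 hlogD
    rw [Real.log_mul (by norm_num) hy0.ne'] at h1
    have h2 : Real.log 2 < 1 := by
      rw [Real.log_lt_iff_lt_exp (by norm_num)]
      have := Real.exp_one_gt_d9; linarith
    rw [hu]; linarith
  set a : ℝ := 8 * d * Real.log 16 * L * L * (d + 1) with ha
  have ha0 : 0 ≤ a := by positivity
  have hDz : 2 * (D : ℝ) / z ≤ a * n / y := by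
    rw [div_le_div_iff₀ hz0 hy0]
    have hDval : (D : ℝ) = 2 * L * L * (d + 1) * n := by rw [hDdef, discMax]; push_cast; rw [hn]
    calc 2 * (D : ℝ) * y ≤ 2 * (D : ℝ) * (2 * c₀ * z) := mul_le_mul_of_nonneg_left hyz' (by positivity)
      _ = a * n * z := by rw [hDval, ha, hc₀def]; ring
  have hn1 : (1 : ℝ) ≤ n := by linarith
  have h1 := term1_le (t := t) hd hn0 hn1 hy0 hu1 hH0 hH hX ha0 hDz hll hsq hsq0
  have h2 := term2_le (t := t) hd hn hn0 hu1 hH hQ hsq1 hsq0 hsqn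
  have h3 := term3_le (d := d) hy0 hu1 hz2r hn0 hc₀0 hyz' hC3 hHbar
  -- combine
  have hq1 : 0 ≤ u ^ (t + 1) * (n ^ (d + 1) / y) := by positivity
  have hq2 : 0 ≤ u ^ (t + 1) * (n ^ (d + 1) / Real.sqrt n) := by positivity
  set α₁ : ℝ := 4 * (t : ℝ) ^ 3 * 3 ^ (d - 1) * Real.exp (5 * t) * Real.exp (32 * (t : ℝ) ^ 3 * d) with hα₁
  set α₃ : ℝ := Real.exp (5 * t) * (2 * (t : ℝ) ^ 2 * 3 ^ (d - 1) + 3 ^ d + (d + 1) * 8 ^ d) with hα₃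
  set α₄ : ℝ := 2 ^ (d + 1) * 2 ^ (t * (tailThreshold t L + 1)) * Real.exp ((t : ℝ) ^ 2) * C₃ ^ (t - 1) *
    (4 * (t : ℝ) ^ 3 * c₀) * Real.exp ((t : ℝ) ^ 3) with hα₄
  have hα₁0 : 0 ≤ α₁ := by positivity
  have hα₃0 : 0 ≤ α₃ := by positivity
  have hα₄0 : 0 ≤ α₄ := by positivity
  set X : ℝ := u ^ (t + 1) * (n ^ (d + 1) / y) with hXdef
  set Y : ℝ := u ^ (t + 1) * (n ^ (d + 1) / Real.sqrt n) with hYdef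
  have hsum := add_le_add (add_le_add h1 h2) h3
  have hre : α₁ * a * X + α₁ * 5 * Y + α₃ * Y + α₄ * X ≤ (α₁ * a + α₁ * 5 + α₃ + α₄) * (X + Y) := by
    have hX0 : 0 ≤ X := hq1
    have hY0 : 0 ≤ Y := hq2
    have hid : (α₁ * a + α₁ * 5 + α₃ + α₄) * (X + Y) - (α₁ * a * X + α₁ * 5 * Y + α₃ * Y + α₄ * X) =
        α₁ * a * Y + α₁ * 5 * X + α₃ * X + α₄ * Y := by ring
    have hpos : 0 ≤ α₁ * a * Y + α₁ * 5 * X + α₃ * X + α₄ * Y := by positivity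
    linarith
  calc _ ≤ tailBound t D * (α₁ * a * X + α₁ * 5 * Y + α₃ * Y + α₄ * X) := mul_le_mul_of_nonneg_left hsum hB0
    _ ≤ (C₃ ^ (t - 1) * u ^ (t - 1)) * ((α₁ * a + α₁ * 5 + α₃ + α₄) * (X + Y)) :=
        mul_le_mul hB hre (by positivity) (by positivity)
    _ = C₃ ^ (t - 1) * (α₁ * a + α₁ * 5 + α₃ + α₄) * (u ^ (t - 1) * u ^ (t + 1)) *
          (n ^ (d + 1) / y + n ^ (d + 1) / Real.sqrt n) := by rw [hXdef, hYdef]; ring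
    _ = _ := by
        rw [← pow_add, show t - 1 + (t + 1) = 2 * t by omega, hα₁, hα₃, hα₄, ha, hC₃def, hc₀def]

end Summit.Parity.GeneralizedHardyLittlewood.Theorems
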